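import Summits.Schanuel.Schanuel.Theorems.DiophantineDichotomyKhovanskiiApproxTypeEvRareFieldThreeLayers
import Summits.Schanuel.Schanuel.Theorems.DiophantineDichotomyKhovanskiiApproxTypeEvFinrankRange
import Summits.Schanuel.Schanuel.Theorems.DiophantineDichotomyKhovanskiiApproxTypeEvClauseAdd

/-!
# A kernel hardness certificate for the naive Lindemann–Weierstrass layer at rank 3 (`stub_pairSumMeasure`)

Line `Sketch` of crux `DiophantineDichotomy.KhovanskiiApproxTypeEv` (stmt-Schanuel-14972), skeleton v8/v9
(lead `prover-line-stmt-Schanuel-14972-c11-0`), registered stub `stub_pairSumMeasure` — `--supports`.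

The crux as filed is kernel-certified `⟺ EvNonLWTwo ∧ (∀ n ≥ 3, EvLW n) ∧ EvNonLWRankThreeUp` (p136816); the
two non-LW leaves carry certificates showing they contain catalogued open problems (`e ⊥ π` p124086, two
algebraically independent logarithms p124970).  The middle leaf — the NAIVE-currency Lindemann–Weierstrass
layer `EvLW n`, `n ≥ 3` (`stub_evLW_rankThreeUp`) — speaks only about points of KNOWN transcendence degree
and was "open for a certificational reason" (certificate-game cap `(n+1)/(2n) ≥ 1/(n−1)`, p136514;
STRATEGY-CENSUS §7, on paper).  This file makes that machine-visible: `EvLW 3` implies a simultaneous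
approximation measure that is NOT in print —

  `stub_pairSumMeasure : EvLW 3 → ∀ s ∈ ℚ̄³ lin. indep., ∃ κ < 5/2, C > 0, ∀ k ∃ h₀ ∀ h ≥ h₀
     ∀ α₀ α₁ α₂` (each a root of a non-zero integer polynomial of degree `≤ k`, naive height `≤ h`; NO
     common-field condition) `: max_j |α_j + α_{j+1} − e^{s_j}| ≥ exp(−C k^κ log h)`,

i.e. the `S_k`-sum species of STRATEGY-CENSUS §7.1 run backwards: the challenger
`γ = (s, α₀+α₁, α₁+α₂, α₂+α₀)` is admissible at level `(N_s k³, 4^{k²}((k+1)h)^{2k})`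
(`stub_finrankAdjoinRangeLe` p143271; `stub_clauseAdd` = resultant `Res_Y(P(Y), Q(X−Y))` with the
Mahler-measure height bound, p143374/p143503/p143542 + ClauseAdd), so the crux's `dᵃ log H + dᵇ` is
`≤ 6 N_sᵃ k^{3a+1} log h` past the threshold `h ≥ max(H₀(d), H_s, 4^k(k+1), exp(dᵇ))`, and `3a + 1 < 5/2`.
Print gives exponent `κ = 3` here (Ably 1994 at `m = 3` on `P ∘ ((x₀ − x₁ + x₂)/2)` for the alternating
half-sums `(e^{s₀} − e^{s₁} + e^{s₂})/2 ≈ α₀`, …; or at `m = 1` on a pair sum of degree `k²`, height `h^{2k}`);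
the heuristic truth is `κ = 1`.  Corollary `pairSum_measure_of_khovanskiiApproxTypeEv`: the same from the crux.
Everything here is proved; no named facts.
-/

noncomputable section

set_option linter.dupNamespace false -- mandated summit/sub-problem namespace (single-conjunct summit)

namespace Summit.Schanuel.Schanuel.Cruxes.KhovanskiiApproxTypeEv.AnchoredReduction

open Summit.Schanuel.Schanuel.Theses.DiophantineDichotomy (KhovanskiiApproxTypeEv)
open Summit.Schanuel.Schanuel.Cruxes.KhovanskiiApproxTypeEv.RareFieldSpecies
  (EvLW khovanskiiApproxTypeEv_iff_threeLayers)
open Polynomial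

/-! ## Bookkeeping lemmas -/

/-- The admissibility clause at degree budget `k` forces `1 ≤ k`. [folklore] -/
theorem one_le_budget_of_clause {z : ℂ} {k H : ℕ}
    (h : ∃ P : Polynomial ℤ, P ≠ 0 ∧ P.natDegree ≤ k ∧ (∀ l, |P.coeff l| ≤ (H : ℤ)) ∧
      Polynomial.aeval z P = 0) : 1 ≤ k := by
  obtain ⟨P, hP0, hdeg, -, hroot⟩ := h
  by_contra hk
  have hk0 : P.natDegree = 0 := by omega
  have hc : P.coeff 0 = 0 := by
    rw [Polynomial.eq_C_of_natDegree_eq_zero hk0] at hroot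
    simpa using hroot
  apply hP0
  rw [Polynomial.eq_C_of_natDegree_eq_zero hk0, hc, map_zero]

/-- An algebraic complex number is a root of a non-zero integer polynomial with SOME coefficient
bound (clear denominators of a rational annihilator). [folklore] -/
theorem exists_intPoly_bound_of_isAlgebraic {x : ℂ} (hx : IsAlgebraic ℚ x) :
    ∃ (T : Polynomial ℤ) (B : ℕ), T ≠ 0 ∧ (∀ l, |T.coeff l| ≤ (B : ℤ)) ∧ Polynomial.aeval x T = 0 := by
  obtain ⟨p, hp0, hp⟩ := hx
  refine ⟨IsLocalization.integerNormalization (nonZeroDivisors ℤ) p, ?_, ?_, ?_,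
    IsLocalization.integerNormalization_aeval_eq_zero (nonZeroDivisors ℤ) p hp⟩
  · exact (IsLocalization.integerNormalization (nonZeroDivisors ℤ) p).support.sup
      fun l => ((IsLocalization.integerNormalization (nonZeroDivisors ℤ) p).coeff l).natAbs
  · rw [Ne, IsLocalization.integerNormalization_eq_zero_iff le_rfl]
    exact hp0
  · intro l
    set T := IsLocalization.integerNormalization (nonZeroDivisors ℤ) p
    by_cases hl : l ∈ T.support
    · have h1 : (T.coeff l).natAbs ≤ T.support.sup fun l => (T.coeff l).natAbs :=
        Finset.le_sup (f := fun l => (T.coeff l).natAbs) hl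
      calc |T.coeff l| = ((T.coeff l).natAbs : ℤ) := (Int.natCast_natAbs _).symm
        _ ≤ _ := by exact_mod_cast h1
    · rw [Polynomial.notMem_support_iff.1 hl, abs_zero]
      positivity

/-- Sup-norm bookkeeping: a challenger whose `z`-part is EXACTLY `s` is as far from `θ = (s, e^s)` as its
`y`-part is from `e^s`. [folklore] -/
theorem norm_elim_sub_le (s : Fin 3 → ℂ) (σ : Fin 3 → ℂ) :
    ‖(Sum.elim s σ : Fin 3 ⊕ Fin 3 → ℂ) - Sum.elim s (Complex.exp ∘ s)‖ ≤
      ‖fun j : Fin 3 => σ j - Complex.exp (s j)‖ := by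
  refine (pi_norm_le_iff_of_nonneg (norm_nonneg _)).2 ?_
  rintro (i | j)
  · simp
  · simpa using norm_le_pi_norm (fun j : Fin 3 => σ j - Complex.exp (s j)) j

/-- The level height of the pair-sum challenger is at most `H^{5k}` once `H ≥ 4^k (k+1)`. [folklore] -/
theorem levelHeight_le_pow {k H : ℕ} (hk : 1 ≤ k) (hH : 4 ^ k * (k + 1) ≤ H) :
    4 ^ (k * k) * ((k + 1) * H) ^ k * ((k + 1) * H) ^ k ≤ H ^ (5 * k) := by
  have h4 : 4 ^ k ≤ H := le_trans (Nat.le_mul_of_pos_right _ (by omega)) hH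
  have hk1 : k + 1 ≤ H := le_trans (Nat.le_mul_of_pos_left _ (by positivity)) hH
  have h1 : 4 ^ (k * k) ≤ H ^ k := by
    rw [pow_mul]; exact Nat.pow_le_pow_left h4 k
  have h2 : ((k + 1) * H) ^ k ≤ H ^ (2 * k) := by
    rw [pow_mul]
    exact Nat.pow_le_pow_left (by nlinarith) k
  calc 4 ^ (k * k) * ((k + 1) * H) ^ k * ((k + 1) * H) ^ k
      ≤ H ^ k * H ^ (2 * k) * H ^ (2 * k) :=
        Nat.mul_le_mul (Nat.mul_le_mul h1 h2) h2
    _ = H ^ (5 * k) := by rw [← pow_add, ← pow_add]; ring_nf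

/-! ## The certificate -/

/-- **`stub_pairSumMeasure` — THE HARDNESS CERTIFICATE OF STUB B** (registered stub of line `Sketch`,
skeleton v8; lead c11).  The naive Lindemann–Weierstrass layer of the crux at rank 3 (`EvLW 3`, leaf
`LWLayerRankThreeUp` of STRATEGY-CENSUS §5) implies, at every LW triple `s ∈ ℚ̄³` with `ℚ`-linearly
independent coordinates: there are `κ < 5/2` and `C > 0` such that for every degree budget `k`, beyond a
threshold `h₀(k)`, any three algebraic numbers `α₀, α₁, α₂` that are roots of non-zero integer polynomials of
degree `≤ k` and naive height `≤ h` (NO common-field condition) satisfy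
`max_j |α_j + α_{j+1} − e^{s_j}| ≥ exp(−C k^κ log h)`.  This is the `S_k`-sum species of STRATEGY-CENSUS §7.1
run backwards: the challenger `(s, α₀+α₁, α₁+α₂, α₂+α₀)` has level `(N_s k³, 4^{k²}((k+1)h)^{2k})`
(`stub_finrankAdjoinRangeLe` p143271, `stub_clauseAdd`), so the crux's `dᵃ log H` is `≍ k^{3a+1} log h` with
`3a + 1 < 5/2`.  PRINT STATUS of the conclusion: exponent `κ = 3` (Ably 1994 at `m = 3` applied to
`P_{α_a} ∘ ((x₀ − x₁ + x₂)/2)` for the alternating half-sums `(e^{s₀} − e^{s₁} + e^{s₂})/2 ≈ α₀`, …, or at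
`m = 1` on a pair sum of degree `k²` and height `h^{2k}`); nothing below `3` is in print (it would be an
order-defect transcendence measure, STRATEGY-CENSUS §7 M2); heuristic truth `κ = 1` (each alternating
half-sum is a single complex number approximated by independent degree-`k` numbers).  So any proof of stub B
proves a transcendence-measure improvement that is itself open. [folklore] -/
theorem stub_pairSumMeasure (h : EvLW 3) (s : Fin 3 → ℂ)
    (halg : ∀ i, IsAlgebraic ℚ (s i)) (hli : LinearIndependent ℚ s) :
    ∃ κ C : ℝ, κ < 5 / 2 ∧ 0 < C ∧ ∀ k : ℕ, ∃ h₀ : ℕ, ∀ (H : ℕ) (α : Fin 3 → ℂ), h₀ ≤ H →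
      (∀ j, ∃ P : Polynomial ℤ, P ≠ 0 ∧ P.natDegree ≤ k ∧ (∀ l, |P.coeff l| ≤ (H : ℤ)) ∧
        Polynomial.aeval (α j) P = 0) →
      Real.exp (-(C * (k : ℝ) ^ κ * Real.log H)) ≤
        ‖fun j : Fin 3 => α j + α (j + 1) - Complex.exp (s j)‖ := by
  obtain ⟨a, b, C, ha, hC, hall⟩ := h s halg hli
  have ha2 : a < 1 / 2 := by norm_num at ha ⊢; linarith
  -- fixed data of the LW point: integer annihilators of the `s i` and the degree of `ℚ(s)`
  have hT : ∀ i, ∃ (T : Polynomial ℤ) (B : ℕ), T ≠ 0 ∧ (∀ l, |T.coeff l| ≤ (B : ℤ)) ∧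
      Polynomial.aeval (s i) T = 0 := fun i => exists_intPoly_bound_of_isAlgebraic (halg i)
  choose T B hT0 hTB hTroot using hT
  set Ks : IntermediateField ℚ ℂ := IntermediateField.adjoin ℚ (Set.range s) with hKs
  haveI : FiniteDimensional ℚ Ks := by
    haveI : Finite (Set.range s) := Set.finite_range s |>.to_subtype
    exact IntermediateField.finiteDimensional_adjoin (fun x hx => by
      obtain ⟨i, rfl⟩ := hx; exact (halg i).isIntegral)
  set M : ℕ := Module.finrank ℚ Ks with hM
  have hM1 : 1 ≤ M := Module.finrank_pos
  set N : ℕ := M + ∑ i, (T i).natDegree with hN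
  have hMN : M ≤ N := Nat.le_add_right _ _
  have hN1 : 1 ≤ N := hM1.trans hMN
  have hTdeg : ∀ i, (T i).natDegree ≤ N := fun i =>
    le_trans (Finset.single_le_sum (f := fun i => (T i).natDegree) (fun _ _ => Nat.zero_le _)
      (Finset.mem_univ i)) (Nat.le_add_left _ _)
  set Hs : ℕ := ∑ i, B i with hHs
  have hBHs : ∀ i, B i ≤ Hs := fun i =>
    Finset.single_le_sum (f := B) (fun _ _ => Nat.zero_le _) (Finset.mem_univ i)
  -- the constants
  set a' : ℝ := max a 0 with ha'
  have ha'0 : 0 ≤ a' := le_max_right _ _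
  have ha'2 : a' < 1 / 2 := max_lt ha2 (by norm_num)
  have hN1r : (1 : ℝ) ≤ N := by exact_mod_cast hN1
  have hNa : 1 ≤ (N : ℝ) ^ a' := Real.one_le_rpow hN1r ha'0
  refine ⟨3 * a' + 1, 6 * C * (N : ℝ) ^ a', by linarith, by positivity, fun k => ?_⟩
  -- degree budget `k = 0` is vacuous
  rcases Nat.eq_zero_or_pos k with hk0 | hk
  · refine ⟨0, fun H α _ hcl => ?_⟩
    have := one_le_budget_of_clause (hcl 0)
    omega
  -- the level of the pair-sum challenger and the threshold
  set d : ℕ := N * k ^ 3 with hd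
  obtain ⟨H₀, hH₀⟩ := hall d
  refine ⟨max (max H₀ Hs) (max (4 ^ k * (k + 1)) ⌈Real.exp (((d : ℕ) : ℝ) ^ b)⌉₊),
    fun H α hH hcl => ?_⟩
  have hH0 : H₀ ≤ H := le_trans (le_trans (le_max_left _ _) (le_max_left _ _)) hH
  have hHs : Hs ≤ H := le_trans (le_trans (le_max_right _ _) (le_max_left _ _)) hH
  have hH4 : 4 ^ k * (k + 1) ≤ H := le_trans (le_trans (le_max_left _ _) (le_max_right _ _)) hH
  have hHb : ⌈Real.exp (((d : ℕ) : ℝ) ^ b)⌉₊ ≤ H :=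
    le_trans (le_trans (le_max_right _ _) (le_max_right _ _)) hH
  have hH2 : 2 ≤ H := le_trans (le_trans (by
    calc 2 ≤ 4 ^ k := le_trans (by norm_num) (Nat.pow_le_pow_right (by norm_num) hk)
      _ ≤ 4 ^ k * (k + 1) := Nat.le_mul_of_pos_right _ (by omega)) (le_max_left _ _))
    (le_trans (le_max_right _ _) hH)
  have hH1r : (1 : ℝ) < H := by exact_mod_cast hH2
  have hHpos : (0 : ℝ) < H := by positivity
  have hlogH : 0 < Real.log H := Real.log_pos hH1r
  -- the level height
  set L : ℕ := 4 ^ (k * k) * ((k + 1) * H) ^ k * ((k + 1) * H) ^ k with hL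
  have hLpow : L ≤ H ^ (5 * k) := levelHeight_le_pow hk hH4
  have hHL : H ≤ L := by
    have h1 : 1 ≤ 4 ^ (k * k) := Nat.one_le_pow _ _ (by norm_num)
    have h2 : H ≤ ((k + 1) * H) ^ k := by
      calc H ≤ (k + 1) * H := Nat.le_mul_of_pos_left _ (by omega)
        _ ≤ ((k + 1) * H) ^ k := Nat.le_self_pow (by omega) _
    have h3 : 1 ≤ ((k + 1) * H) ^ k := le_trans (by omega) h2
    calc H ≤ ((k + 1) * H) ^ k := h2
      _ = 1 * ((k + 1) * H) ^ k * 1 := by ring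
      _ ≤ 4 ^ (k * k) * ((k + 1) * H) ^ k * ((k + 1) * H) ^ k :=
        Nat.mul_le_mul (Nat.mul_le_mul h1 le_rfl) h3
  have hL0 : H₀ ≤ L := hH0.trans hHL
  have hLpos : (0 : ℝ) < L := by exact_mod_cast (lt_of_lt_of_le (by omega) hHL : 0 < L)
  have hlogL : Real.log L ≤ 5 * k * Real.log H := by
    have h1 : (L : ℝ) ≤ (H : ℝ) ^ (5 * k) := by exact_mod_cast hLpow
    calc Real.log L ≤ Real.log ((H : ℝ) ^ (5 * k)) := Real.log_le_log hLpos h1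
      _ = 5 * k * Real.log H := by rw [Real.log_pow]; push_cast; ring
  -- the challenger `γ = (s, α₀+α₁, α₁+α₂, α₂+α₀)` and its admissibility at level `(d, L)`
  set σ : Fin 3 → ℂ := fun j => α j + α (j + 1) with hσ
  set γ : Fin 3 ⊕ Fin 3 → ℂ := Sum.elim s σ with hγ
  have hk3 : 1 ≤ k ^ 3 := Nat.one_le_pow _ _ hk
  have hNd : N ≤ d := by rw [hd]; exact Nat.le_mul_of_pos_right _ hk3
  have hkkd : k * k ≤ d := by
    calc k * k ≤ k ^ 3 := by rw [pow_succ, sq]; exact Nat.le_mul_of_pos_right _ hk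
      _ ≤ N * k ^ 3 := Nat.le_mul_of_pos_left _ hN1
  have hclause : ∀ i, ∃ P : Polynomial ℤ, P ≠ 0 ∧ P.natDegree ≤ d ∧ (∀ l, |P.coeff l| ≤ (L : ℤ)) ∧
      Polynomial.aeval (γ i) P = 0 := by
    rintro (i | j)
    · refine ⟨T i, hT0 i, (hTdeg i).trans hNd, fun l => (hTB i l).trans ?_, hTroot i⟩
      exact_mod_cast (hBHs i).trans (hHs.trans hHL)
    · obtain ⟨R, hR0, hRdeg, hRH, hRroot⟩ := stub_clauseAdd (hcl j) (hcl (j + 1))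
      exact ⟨R, hR0, hRdeg.trans hkkd, fun l => by simpa [hL] using hRH l, hRroot⟩
  have hfr : Module.finrank ℚ ↥(IntermediateField.adjoin ℚ (Set.range γ)) ≤ d := by
    set Kα : IntermediateField ℚ ℂ := IntermediateField.adjoin ℚ (Set.range α) with hKα
    have hint : ∀ j, IsIntegral ℚ (α j) := by
      intro j
      obtain ⟨P, hP0, -, -, hroot⟩ := hcl j
      refine (isAlgebraic_iff_isIntegral.mp ⟨P.map (algebraMap ℤ ℚ), ?_, ?_⟩)
      · exact (Polynomial.map_ne_zero_iff (algebraMap ℤ ℚ).injective_int).mpr hP0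
      · rw [Polynomial.aeval_map_algebraMap]; exact hroot
    haveI : FiniteDimensional ℚ Kα := by
      haveI : Finite (Set.range α) := Set.finite_range α |>.to_subtype
      exact IntermediateField.finiteDimensional_adjoin (fun x hx => by
        obtain ⟨j, rfl⟩ := hx; exact hint j)
    have hKα : Module.finrank ℚ Kα ≤ k ^ 3 := by
      have h := stub_finrankAdjoinRangeLe α (fun _ => k)
        (fun j => by obtain ⟨P, hP0, hdeg, -, hroot⟩ := hcl j; exact ⟨P, hP0, hdeg, hroot⟩)
      simpa [Finset.prod_const, Finset.card_univ, Fintype.card_fin] using h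
    have hle : IntermediateField.adjoin ℚ (Set.range γ) ≤ Ks ⊔ Kα := by
      rw [IntermediateField.adjoin_le_iff]
      rintro _ ⟨i | j, rfl⟩
      · exact (le_sup_left : Ks ≤ Ks ⊔ Kα) (IntermediateField.subset_adjoin ℚ _ ⟨i, rfl⟩)
      · have hα : ∀ j', α j' ∈ Ks ⊔ Kα := fun j' =>
          (le_sup_right : Kα ≤ Ks ⊔ Kα) (IntermediateField.subset_adjoin ℚ _ ⟨j', rfl⟩)
        exact add_mem (hα j) (hα (j + 1))
    calc Module.finrank ℚ ↥(IntermediateField.adjoin ℚ (Set.range γ))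
        ≤ Module.finrank ℚ ↥(Ks ⊔ Kα) := IntermediateField.finrank_le_of_le_right hle
      _ ≤ Module.finrank ℚ Ks * Module.finrank ℚ Kα := IntermediateField.finrank_sup_le Ks Kα
      _ ≤ N * k ^ 3 := Nat.mul_le_mul hMN hKα
  -- the crux's bound at level `(d, L)`
  have hmain := hH₀ L γ hL0 hfr hclause
  -- compare the exponents: `C (dᵃ log L + dᵇ) ≤ 6 C Nᵃ' k^{3a'+1} log H`
  have hd1 : (1 : ℝ) ≤ d := by exact_mod_cast hN1.trans hNd
  have hdcast : (d : ℝ) = (N : ℝ) * (k : ℝ) ^ (3 : ℕ) := by rw [hd]; push_cast; ring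
  have hk0r : (0 : ℝ) ≤ k := Nat.cast_nonneg k
  have hk1r : (1 : ℝ) ≤ k := by exact_mod_cast hk
  have hda : (d : ℝ) ^ a ≤ (d : ℝ) ^ a' := Real.rpow_le_rpow_of_exponent_le hd1 (le_max_left _ _)
  have hda' : (d : ℝ) ^ a' = (N : ℝ) ^ a' * (k : ℝ) ^ (3 * a') := by
    rw [hdcast, Real.mul_rpow (by positivity) (by positivity), ← Real.rpow_natCast,
      ← Real.rpow_mul hk0r]
    push_cast
    ring_nf
  have hkκ : (k : ℝ) ^ (3 * a') * k = (k : ℝ) ^ (3 * a' + 1) := by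
    rw [Real.rpow_add_one (by positivity)]
  have hkκ1 : 1 ≤ (k : ℝ) ^ (3 * a' + 1) := Real.one_le_rpow hk1r (by linarith)
  have hdb : ((d : ℕ) : ℝ) ^ b ≤ Real.log H := by
    rw [Real.le_log_iff_exp_le hHpos]
    exact (Nat.le_ceil _).trans (by exact_mod_cast hHb)
  have hlogL0 : 0 ≤ Real.log L := Real.log_nonneg (by exact_mod_cast (lt_of_lt_of_le (by omega) hHL : 0 < L))
  have key : C * ((d : ℝ) ^ a * Real.log L + (d : ℝ) ^ b) ≤
      6 * C * (N : ℝ) ^ a' * (k : ℝ) ^ (3 * a' + 1) * Real.log H := by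
    have h1 : (d : ℝ) ^ a * Real.log L ≤ (N : ℝ) ^ a' * (k : ℝ) ^ (3 * a') * (5 * k * Real.log H) := by
      calc (d : ℝ) ^ a * Real.log L ≤ (d : ℝ) ^ a' * Real.log L :=
            mul_le_mul_of_nonneg_right hda hlogL0
        _ ≤ (d : ℝ) ^ a' * (5 * k * Real.log H) :=
            mul_le_mul_of_nonneg_left hlogL (by positivity)
        _ = (N : ℝ) ^ a' * (k : ℝ) ^ (3 * a') * (5 * k * Real.log H) := by rw [hda']
    have h1' : (d : ℝ) ^ a * Real.log L ≤ 5 * ((N : ℝ) ^ a' * (k : ℝ) ^ (3 * a' + 1) * Real.log H) := by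
      calc (d : ℝ) ^ a * Real.log L ≤ (N : ℝ) ^ a' * (k : ℝ) ^ (3 * a') * (5 * k * Real.log H) := h1
        _ = 5 * ((N : ℝ) ^ a' * ((k : ℝ) ^ (3 * a') * k) * Real.log H) := by ring
        _ = 5 * ((N : ℝ) ^ a' * (k : ℝ) ^ (3 * a' + 1) * Real.log H) := by rw [hkκ]
    have h2 : (d : ℝ) ^ b ≤ (N : ℝ) ^ a' * (k : ℝ) ^ (3 * a' + 1) * Real.log H := by
      calc (d : ℝ) ^ b ≤ Real.log H := hdb
        _ = 1 * 1 * Real.log H := by ring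
        _ ≤ (N : ℝ) ^ a' * (k : ℝ) ^ (3 * a' + 1) * Real.log H :=
            mul_le_mul_of_nonneg_right (mul_le_mul hNa hkκ1 zero_le_one (by positivity)) hlogH.le
    nlinarith [h1', h2, hC]
  calc Real.exp (-(6 * C * (N : ℝ) ^ a' * (k : ℝ) ^ (3 * a' + 1) * Real.log H))
      ≤ Real.exp (-(C * ((d : ℝ) ^ a * Real.log L + (d : ℝ) ^ b))) :=
        Real.exp_le_exp.2 (neg_le_neg key)
    _ ≤ ‖γ - Sum.elim s (Complex.exp ∘ s)‖ := hmain
    _ ≤ ‖fun j : Fin 3 => σ j - Complex.exp (s j)‖ := norm_elim_sub_le s σ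

/-- Sup-norm bookkeeping for the alternating half-sums `ξ_j = (e^{s_j} − e^{s_{j+1}} + e^{s_{j+2}})/2`:
since `ξ_j + ξ_{j+1} = e^{s_j}` (indices mod 3), `max_j |α_j + α_{j+1} − e^{s_j}| ≤ 2 max_j |α_j − ξ_j|`. [folklore] -/
theorem norm_pairSum_sub_le (e α : Fin 3 → ℂ) :
    ‖fun j : Fin 3 => α j + α (j + 1) - e j‖ ≤
      2 * ‖fun j : Fin 3 => α j - (e j - e (j + 1) + e (j + 2)) / 2‖ := by
  set ξ : Fin 3 → ℂ := fun j => (e j - e (j + 1) + e (j + 2)) / 2 with hξ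
  refine (pi_norm_le_iff_of_nonneg (by positivity)).2 fun j => ?_
  have hsum : ξ j + ξ (j + 1) = e j := by
    have h3 : j + 1 + 2 = j := by
      rw [add_assoc]
      exact add_eq_left.2 (by decide)
    have h2 : j + 1 + 1 = j + 2 := by rw [add_assoc]; rfl
    simp only [hξ, h2, h3]
    ring
  have hid : α j + α (j + 1) - e j = (α j - ξ j) + (α (j + 1) - ξ (j + 1)) := by
    rw [← hsum]; ring
  calc ‖α j + α (j + 1) - e j‖ = ‖(α j - ξ j) + (α (j + 1) - ξ (j + 1))‖ := by rw [hid]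
    _ ≤ ‖α j - ξ j‖ + ‖α (j + 1) - ξ (j + 1)‖ := norm_add_le _ _
    _ ≤ ‖fun i : Fin 3 => α i - ξ i‖ + ‖fun i : Fin 3 => α i - ξ i‖ :=
        add_le_add (norm_le_pi_norm (fun i : Fin 3 => α i - ξ i) j)
          (norm_le_pi_norm (fun i : Fin 3 => α i - ξ i) (j + 1))
    _ = 2 * ‖fun i : Fin 3 => α i - ξ i‖ := by ring

/-- **The certificate in single-number form**: `EvLW 3` implies that the three alternating half-sums
`ξ_j = (e^{s_j} − e^{s_{j+1}} + e^{s_{j+2}})/2` of an LW triple cannot be SIMULTANEOUSLY approximated by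
INDEPENDENT algebraic numbers of degree `≤ k` and naive height `≤ h` to within `exp(−C k^κ log h)`, for some
`κ < 5/2` (eventually in `h`).  Each `ξ_j` is the value of an order-3 exponential sum; a transcendence measure for ONE
such number against degree-`k` polynomials with exponent `k^κ`, `κ < 3`, is not in print (Ably 1994 / Lang–Galochkin
give `k³`), and Dirichlet/metric heuristics predict `κ = 1` — this is the `OrderDefectMeasure`-type content of
stub B (STRATEGY-CENSUS §7, M2) as a kernel theorem. [folklore] -/
theorem alternatingSum_measure_of_evLW_three (h : EvLW 3) (s : Fin 3 → ℂ)
    (halg : ∀ i, IsAlgebraic ℚ (s i)) (hli : LinearIndependent ℚ s) :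
    ∃ κ C : ℝ, κ < 5 / 2 ∧ 0 < C ∧ ∀ k : ℕ, ∃ h₀ : ℕ, ∀ (H : ℕ) (α : Fin 3 → ℂ), h₀ ≤ H →
      (∀ j, ∃ P : Polynomial ℤ, P ≠ 0 ∧ P.natDegree ≤ k ∧ (∀ l, |P.coeff l| ≤ (H : ℤ)) ∧
        Polynomial.aeval (α j) P = 0) →
      Real.exp (-(C * (k : ℝ) ^ κ * Real.log H)) ≤
        ‖fun j : Fin 3 => α j -
          (Complex.exp (s j) - Complex.exp (s (j + 1)) + Complex.exp (s (j + 2))) / 2‖ := by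
  obtain ⟨κ, C, hκ, hC, hk⟩ := stub_pairSumMeasure h s halg hli
  -- `κ ≥ 0` may fail in principle; use `k^κ ≥ 1` only through `1 ≤ k` and a case split on the sign is avoided by
  -- enlarging the constant to `C + 1` and the threshold to `H ≥ 2`, using `C k^κ log H + log 2 ≤ (C+1) k^κ log H`
  -- whenever `k^κ log H ≥ log 2`; for that we need `1 ≤ k^κ`, which holds when `0 ≤ κ`; if `κ < 0` we first
  -- replace `κ` by `0` (the pair-sum bound is monotone in `κ` for `k ≥ 1`).
  refine ⟨max κ 0, C + 1, max_lt hκ (by norm_num), by linarith, fun k => ?_⟩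
  obtain ⟨h₀, hh₀⟩ := hk k
  refine ⟨max h₀ 2, fun H α hH hcl => ?_⟩
  have hk1 : 1 ≤ k := one_le_budget_of_clause (hcl 0)
  have hk1r : (1 : ℝ) ≤ k := by exact_mod_cast hk1
  have hH2 : (2 : ℝ) ≤ H := by exact_mod_cast le_trans (le_max_right _ _) hH
  have hlogH : Real.log 2 ≤ Real.log H := Real.log_le_log (by norm_num) hH2
  have hlog2 : 0 < Real.log 2 := Real.log_pos (by norm_num)
  have hlogH0 : 0 ≤ Real.log H := hlog2.le.trans hlogH
  have hmain := hh₀ H α (le_trans (le_max_left _ _) hH) hcl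
  have hkκ : (k : ℝ) ^ κ ≤ (k : ℝ) ^ (max κ 0) := Real.rpow_le_rpow_of_exponent_le hk1r (le_max_left _ _)
  have hkκ1 : 1 ≤ (k : ℝ) ^ (max κ 0) := Real.one_le_rpow hk1r (le_max_right _ _)
  have key : C * (k : ℝ) ^ κ * Real.log H + Real.log 2 ≤ (C + 1) * (k : ℝ) ^ (max κ 0) * Real.log H := by
    have h1 : C * (k : ℝ) ^ κ * Real.log H ≤ C * (k : ℝ) ^ (max κ 0) * Real.log H :=
      mul_le_mul_of_nonneg_right (mul_le_mul_of_nonneg_left hkκ hC.le) hlogH0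
    have h2 : Real.log 2 ≤ (k : ℝ) ^ (max κ 0) * Real.log H :=
      hlogH.trans (le_mul_of_one_le_left hlogH0 hkκ1)
    nlinarith [h1, h2]
  have h2 : (0 : ℝ) < 2 := by norm_num
  calc Real.exp (-((C + 1) * (k : ℝ) ^ (max κ 0) * Real.log H))
      ≤ Real.exp (-(C * (k : ℝ) ^ κ * Real.log H + Real.log 2)) := Real.exp_le_exp.2 (neg_le_neg key)
    _ = Real.exp (-(C * (k : ℝ) ^ κ * Real.log H)) / 2 := by
        rw [neg_add, Real.exp_add, Real.exp_neg (Real.log 2), Real.exp_log h2, div_eq_mul_inv]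
    _ ≤ ‖fun j : Fin 3 => α j + α (j + 1) - Complex.exp (s j)‖ / 2 :=
        div_le_div_of_nonneg_right hmain h2.le
    _ ≤ ‖fun j : Fin 3 => α j -
          (Complex.exp (s j) - Complex.exp (s (j + 1)) + Complex.exp (s (j + 2))) / 2‖ := by
        rw [div_le_iff₀ h2, mul_comm]
        exact norm_pairSum_sub_le (fun j => Complex.exp (s j)) α

/-- **The certificate from the crux itself**: `KhovanskiiApproxTypeEv` (stmt-Schanuel-14972) contains the
rank-3 naive LW layer (`khovanskiiApproxTypeEv_iff_threeLayers`, p136816), hence the pair-sum measure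
with `κ < 5/2` at every Lindemann–Weierstrass triple. [folklore] -/
theorem pairSum_measure_of_khovanskiiApproxTypeEv (h : KhovanskiiApproxTypeEv) (s : Fin 3 → ℂ)
    (halg : ∀ i, IsAlgebraic ℚ (s i)) (hli : LinearIndependent ℚ s) :
    ∃ κ C : ℝ, κ < 5 / 2 ∧ 0 < C ∧ ∀ k : ℕ, ∃ h₀ : ℕ, ∀ (H : ℕ) (α : Fin 3 → ℂ), h₀ ≤ H →
      (∀ j, ∃ P : Polynomial ℤ, P ≠ 0 ∧ P.natDegree ≤ k ∧ (∀ l, |P.coeff l| ≤ (H : ℤ)) ∧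
        Polynomial.aeval (α j) P = 0) →
      Real.exp (-(C * (k : ℝ) ^ κ * Real.log H)) ≤
        ‖fun j : Fin 3 => α j + α (j + 1) - Complex.exp (s j)‖ :=
  stub_pairSumMeasure ((khovanskiiApproxTypeEv_iff_threeLayers.1 h).2.1 3 le_rfl) s halg hli

end Summit.Schanuel.Schanuel.Cruxes.KhovanskiiApproxTypeEv.AnchoredReduction

end
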